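import Summits.HubbardSuperconductivity.HubbardSuperconductivity.Theorems.KLProgrammeKLRegimeScaleZeroBetaWindowReduction

/-!
# Route `KLProgramme`, crux K3 — engine-flow child (stmt-HubbardSuperconductivity-20437), stub (C) at `n = 0`, located item #22a «(C)-SCALE0-PT2»,
# β-layer §2c-(W): the CELL READER of the one-octave certificate — a finite table of interval enclosures bounds the sunset majorant for every `β ≥ β₀`

Cell gate-hubbard-kl, seat p1 g19; continues `…ScaleZeroBetaWindowReduction` (the β-WINDOW REDUCTION: the image-sum sunset majorant
`I(β) = ∫_{(0,β]} E_β(τ)²·Ē_β(β − τ) dτ`, `E_β(τ) = Σ_m p(τ + mβ)`, satisfies `I(kβ) ≤ I(β)`, so one octave `β ∈ [β₀, 2β₀)` controls all `β ≥ β₀`).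
Here the octave itself is reduced to a FINITE TABLE, with NO derivative / Lipschitz input (every entry is an interval-arithmetic enclosure the kit produces):

* §1 `lintegral_comp_mul_left_real`, `setLIntegral_Ioc_eq_mul_unit` — the substitution `τ = βs`: `∫_{(0,β]} F = β·∫_{(0,1]} F(βs) ds`, under which the images
  read `E_β(βs) = Σ_m p(β(s + m))`, `Ē_β(β − βs) = Σ_m q(β(1 − s + m))` — `β` enters only as a FACTOR inside the profiles' arguments;
* §2 `setLIntegral_unit_le_sum_cells` — the step majorant on a uniform `N`-grid of `(0,1]`: `∫_{(0,1]} F ≤ Σ_{j<N} (1/N)·M_j` if `F ≤ M_j` on the `j`-th cell;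
* §3 **`sunsetShape_le_of_cellTable`** — for `β ∈ [β₁, β₂]` (`0 < β₁`): if `M_j ≥ sup {E²Ē at (β, s) : β ∈ [β₁,β₂], s ∈ ((j/N), (j+1)/N]}` for each `j < N`
  (exactly what interval evaluation of the profiles at the interval arguments `[β₁,β₂]·(s-cell + m)` delivers), then `I(β) ≤ β₂·Σ_j (1/N)·M_j`;
* §4 **`sunsetShape_le_of_octaveTable`** — with `K` uniform β-cells `[β₀(1 + i/K), β₀(1 + (i+1)/K)]` covering the octave and a table `M i j` as in §3 per
  β-cell: `(∀ i, β₀(1+(i+1)/K)·Σ_j (1/N)·M i j ≤ S) → ∀ β′ ≥ β₀, I(β′) ≤ S` (§3 on the cell containing `β′/⌊β′/β₀⌋`, then the window reduction).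

So the certified surface of the β-layer is `K·N` enclosures of `(Σ_{|m|≤m₀} p([β-cell]·([s-cell] + m)) + tail)²·(…)` — no β-grid beyond one octave, no monotone hull,
no `∂_β`/(E1) Lipschitz constant.  Pure measure theory; values in `ℝ≥0∞`; nothing here asserts (C), any stub of 20437, K3 or superconductivity.  No definitions.
-/

noncomputable section

namespace Summit.HubbardSuperconductivity.HubbardSuperconductivity.Theorems.KLRegimeSplit

set_option linter.dupNamespace false -- summit = problem name (single-conjunct summit), D-0017

open MeasureTheory Set Finset
open scoped ENNReal

/-! ## §1 The substitution `τ = βs` -/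

/-- Lebesgue scaling on `ℝ`: `∫ F(a x) dx = |a⁻¹|·∫ F` (`a ≠ 0`), for `ℝ≥0∞`-valued `F`. -/
theorem lintegral_comp_mul_left_real (F : ℝ → ℝ≥0∞) {a : ℝ} (ha : a ≠ 0) :
    ∫⁻ x : ℝ, F (a * x) = ENNReal.ofReal |a⁻¹| * ∫⁻ y : ℝ, F y := by
  have h := lintegral_map_equiv (μ := (volume : Measure ℝ)) F (MeasurableEquiv.mulLeft₀ a ha)
  have hcoe : ⇑(MeasurableEquiv.mulLeft₀ a ha) = fun x : ℝ => a * x := rfl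
  rw [hcoe, Real.map_volume_mul_left ha, lintegral_smul_measure] at h
  rw [← h, smul_eq_mul]

/-- **`∫_{(0,β]} F = β·∫_{(0,1]} F(βs) ds`** for `β > 0`. -/
theorem setLIntegral_Ioc_eq_mul_unit (F : ℝ → ℝ≥0∞) {β : ℝ} (hβ : 0 < β) :
    ∫⁻ τ in Ioc 0 β, F τ = ENNReal.ofReal β * ∫⁻ s in Ioc 0 1, F (β * s) := by
  rw [← lintegral_indicator measurableSet_Ioc, ← lintegral_indicator measurableSet_Ioc]
  have h : (fun s : ℝ => (Set.Ioc (0 : ℝ) 1).indicator (fun s => F (β * s)) s) = fun s => (Set.Ioc 0 β).indicator F (β * s) := by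
    funext s
    by_cases hs : s ∈ Set.Ioc (0 : ℝ) 1
    · rw [indicator_of_mem hs, indicator_of_mem]
      exact ⟨by nlinarith [hs.1], by nlinarith [hs.2]⟩
    · rw [indicator_of_notMem hs, indicator_of_notMem]
      intro h'
      apply hs
      constructor
      · by_contra hle
        rw [not_lt] at hle
        have : β * s ≤ 0 := mul_nonpos_of_nonneg_of_nonpos hβ.le hle
        linarith [h'.1]
      · by_contra hlt
        rw [not_le] at hlt
        have : β * 1 < β * s := mul_lt_mul_of_pos_left hlt hβ
        linarith [h'.2]
  rw [h, lintegral_comp_mul_left_real _ hβ.ne', ← mul_assoc, abs_of_pos (inv_pos.2 hβ),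
    ← ENNReal.ofReal_mul hβ.le, mul_inv_cancel₀ hβ.ne', ENNReal.ofReal_one, one_mul]

/-! ## §2 The step majorant on a uniform grid of `(0,1]` -/

/-- **Step majorant**: if `F ≤ M_j` on `((j/N), (j+1)/N]` for every `j < N` (`N ≥ 1`), then `∫_{(0,1]} F ≤ Σ_{j<N} (1/N)·M_j`. -/
theorem setLIntegral_unit_le_sum_cells (F : ℝ → ℝ≥0∞) (N : ℕ) (hN : 0 < N) (M : ℕ → ℝ≥0∞)
    (hM : ∀ j : ℕ, j < N → ∀ s : ℝ, (j : ℝ) / N < s → s ≤ ((j : ℝ) + 1) / N → F s ≤ M j) :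
    ∫⁻ s in Ioc 0 1, F s ≤ ∑ j ∈ Finset.range N, ENNReal.ofReal (1 / N) * M j := by
  have hNr : (0 : ℝ) < N := by exact_mod_cast hN
  have hone : (1 : ℝ) = (N : ℝ) * (1 / N) := by field_simp
  have hset : Set.Ioc (0 : ℝ) 1 = Set.Ioc 0 ((N : ℝ) * (1 / N)) := by rw [← hone]
  rw [hset, ← sum_setLIntegral_Ioc_eq F (by positivity) N]
  refine Finset.sum_le_sum fun j hj => ?_
  rw [Finset.mem_range] at hj
  calc ∫⁻ τ in Ioc ((j : ℝ) * (1 / N)) ((j : ℝ) * (1 / N) + 1 / N), F τ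
      ≤ ∫⁻ _ in Ioc ((j : ℝ) * (1 / N)) ((j : ℝ) * (1 / N) + 1 / N), M j :=
        setLIntegral_mono' measurableSet_Ioc fun s hs => hM j hj s
          (by rw [div_eq_mul_one_div]; exact hs.1) (by rw [div_eq_mul_one_div, add_mul, one_mul]; exact hs.2)
    _ = ENNReal.ofReal (1 / N) * M j := by
        rw [setLIntegral_const, Real.volume_Ioc, mul_comm]
        congr 2
        ring

/-! ## §3 One β-cell: a finite table of enclosures bounds `I(β)` on `[β₁, β₂]` -/

/-- **Cell reader**: let `0 < β₁ ≤ β₂`, `N ≥ 1`, and suppose that for each `j < N` the number `M_j` bounds the rescaled sunset integrand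
`(Σ_m p(β(s+m)))²·(Σ_m q(β(1−s+m)))` for all `β ∈ [β₁, β₂]` and `s ∈ (j/N, (j+1)/N]`.  Then for every `β ∈ [β₁, β₂]`:
`∫_{(0,β]} E_β(τ)²·Ē_β(β−τ) dτ ≤ β₂·Σ_{j<N} (1/N)·M_j`. -/
theorem sunsetShape_le_of_cellTable (p q : ℝ → ℝ≥0∞) {β₁ β₂ : ℝ} (hβ₁ : 0 < β₁) (N : ℕ) (hN : 0 < N) (M : ℕ → ℝ≥0∞)
    (hM : ∀ j : ℕ, j < N → ∀ β : ℝ, β₁ ≤ β → β ≤ β₂ → ∀ s : ℝ, (j : ℝ) / N < s → s ≤ ((j : ℝ) + 1) / N →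
      (∑' m : ℤ, p (β * (s + m))) ^ 2 * (∑' m : ℤ, q (β * (1 - s + m))) ≤ M j)
    {β : ℝ} (h₁ : β₁ ≤ β) (h₂ : β ≤ β₂) :
    ∫⁻ τ in Ioc 0 β, (∑' m : ℤ, p (τ + m * β)) ^ 2 * (∑' m : ℤ, q (β - τ + m * β)) ≤
      ENNReal.ofReal β₂ * ∑ j ∈ Finset.range N, ENNReal.ofReal (1 / N) * M j := by
  have hβ : 0 < β := lt_of_lt_of_le hβ₁ h₁
  rw [setLIntegral_Ioc_eq_mul_unit _ hβ]
  refine mul_le_mul' (ENNReal.ofReal_le_ofReal h₂) ?_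
  refine setLIntegral_unit_le_sum_cells _ N hN M fun j hj s hs1 hs2 => ?_
  have hresc : (∑' m : ℤ, p (β * s + m * β)) ^ 2 * (∑' m : ℤ, q (β - β * s + m * β)) =
      (∑' m : ℤ, p (β * (s + m))) ^ 2 * (∑' m : ℤ, q (β * (1 - s + m))) := by
    congr 3
    · ext m; ring_nf
    · ext m; ring_nf
  rw [hresc]
  exact hM j hj β h₁ h₂ s hs1 hs2

/-! ## §4 The octave table ⇒ every `β ≥ β₀` -/

/-- Locating a point of the octave `[β₀, 2β₀)` in one of `K` uniform cells `[β₀(1 + i/K), β₀(1 + (i+1)/K)]`. -/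
theorem exists_cell_of_mem_octave {β₀ β : ℝ} (hβ₀ : 0 < β₀) (K : ℕ) (hK : 0 < K) (h1 : β₀ ≤ β) (h2 : β < 2 * β₀) :
    ∃ i : ℕ, i < K ∧ β₀ * (1 + (i : ℝ) / K) ≤ β ∧ β ≤ β₀ * (1 + ((i : ℝ) + 1) / K) := by
  have hKr : (0 : ℝ) < K := by exact_mod_cast hK
  set x : ℝ := (β / β₀ - 1) * K with hx
  have hx0 : 0 ≤ x := by
    have : 1 ≤ β / β₀ := by rw [le_div_iff₀ hβ₀]; linarith
    rw [hx]; exact mul_nonneg (by linarith) hKr.le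
  have hxK : x < K := by
    have : β / β₀ < 2 := by rw [div_lt_iff₀ hβ₀]; linarith
    rw [hx]; nlinarith
  refine ⟨⌊x⌋₊, ?_, ?_, ?_⟩
  · exact (Nat.floor_lt hx0).2 hxK
  · have hf : (⌊x⌋₊ : ℝ) ≤ x := Nat.floor_le hx0
    have : (⌊x⌋₊ : ℝ) / K ≤ β / β₀ - 1 := by rw [div_le_iff₀ hKr]; linarith
    have : 1 + (⌊x⌋₊ : ℝ) / K ≤ β / β₀ := by linarith
    calc β₀ * (1 + (⌊x⌋₊ : ℝ) / K) ≤ β₀ * (β / β₀) := mul_le_mul_of_nonneg_left this hβ₀.le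
      _ = β := mul_div_cancel₀ _ hβ₀.ne'
  · have hf : x < (⌊x⌋₊ : ℝ) + 1 := Nat.lt_floor_add_one x
    have : β / β₀ - 1 ≤ ((⌊x⌋₊ : ℝ) + 1) / K := by rw [le_div_iff₀ hKr]; linarith
    have : β / β₀ ≤ 1 + ((⌊x⌋₊ : ℝ) + 1) / K := by linarith
    calc β = β₀ * (β / β₀) := (mul_div_cancel₀ _ hβ₀.ne').symm
      _ ≤ β₀ * (1 + ((⌊x⌋₊ : ℝ) + 1) / K) := mul_le_mul_of_nonneg_left this hβ₀.le

/-- **Octave reader ⇒ all `β ≥ β₀`**: `K ≥ 1` uniform β-cells `[β₀(1+i/K), β₀(1+(i+1)/K)]` (covering `[β₀, 2β₀]`), `N ≥ 1` uniform `s`-cells, and a table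
`M i j` with `(Σ_m p(β(s+m)))²·(Σ_m q(β(1−s+m))) ≤ M i j` on (β-cell `i`) × (s-cell `j`); if every row total satisfies
`β₀(1+(i+1)/K)·Σ_j (1/N)·M i j ≤ S`, then the sunset majorant obeys `∫_{(0,β′]} E_{β′}²·Ē_{β′}(β′−·) ≤ S` for EVERY `β′ ≥ β₀` — only measurability of
the (nonnegative) profiles is assumed. -/
theorem sunsetShape_le_of_octaveTable {p q : ℝ → ℝ≥0∞} (hp : Measurable p) (hq : Measurable q) {β₀ : ℝ} (hβ₀ : 0 < β₀)
    (K N : ℕ) (hK : 0 < K) (hN : 0 < N) (M : ℕ → ℕ → ℝ≥0∞) {S : ℝ≥0∞}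
    (hM : ∀ i : ℕ, i < K → ∀ j : ℕ, j < N → ∀ β : ℝ, β₀ * (1 + (i : ℝ) / K) ≤ β → β ≤ β₀ * (1 + ((i : ℝ) + 1) / K) →
      ∀ s : ℝ, (j : ℝ) / N < s → s ≤ ((j : ℝ) + 1) / N →
        (∑' m : ℤ, p (β * (s + m))) ^ 2 * (∑' m : ℤ, q (β * (1 - s + m))) ≤ M i j)
    (hS : ∀ i : ℕ, i < K → ENNReal.ofReal (β₀ * (1 + ((i : ℝ) + 1) / K)) * ∑ j ∈ Finset.range N, ENNReal.ofReal (1 / N) * M i j ≤ S)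
    {β' : ℝ} (hβ' : β₀ ≤ β') :
    ∫⁻ τ in Ioc 0 β', (∑' m : ℤ, p (τ + m * β')) ^ 2 * (∑' m : ℤ, q (β' - τ + m * β')) ≤ S := by
  refine sunsetShape_le_of_window hp hq hβ₀ (fun β h1 h2 => ?_) hβ'
  obtain ⟨i, hi, hc1, hc2⟩ := exists_cell_of_mem_octave hβ₀ K hK h1 h2
  have hKr : (0 : ℝ) < K := by exact_mod_cast hK
  have hβ₁ : 0 < β₀ * (1 + (i : ℝ) / K) := by positivity
  exact (sunsetShape_le_of_cellTable p q hβ₁ N hN (M i) (fun j hj β hb1 hb2 s hs1 hs2 => hM i hi j hj β hb1 hb2 s hs1 hs2) hc1 hc2).trans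
    (hS i hi)

end Summit.HubbardSuperconductivity.HubbardSuperconductivity.Theorems.KLRegimeSplit

end
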